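import Summits.CriticalPhenomena.PercolationContinuityZ3.Theorems.PercNearOneGluingNoHeavyQuantFarRelayRowBlockCombStrong
import Summits.CriticalPhenomena.PercolationContinuityZ3.Theorems.PercNearOneGluingNoHeavyQuantBlockCombRow
import HarnessLib

/-!
# QUANT lane R8: THE BLOCK-COMB ROW in gate coordinates and in ROUTE VOCABULARY — `Quant.FarRelayRow`'s body at every layer for every
# tree-supported weight pattern with a block-comb presentation, under FAR's own hypothesis `2j < Σ_{b∈A} P(o ↔ b)`

builds on p205010 (kernel theorem, internal audit signed; external expert review pending)

Support file (`--supports stmt-CriticalPhenomena-4575`), QUANT lane seat prim-quant-p1 (gen 9); memo `run/shared/lean/prim/quant/P1-SURPLUS.md` §20.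
The wrappers of `Quant.BlockComb.tail_ge_of_le_marg_of_mean` (`…QuantBlockCombRow.lean`, same seat: the canonical block-comb row — half-class merge
induction OR Markov on the deficit) along p1 g8's identification `Quant.BlockCombGate.real_heavy_eq_tail` (`…QuantFarTreeBlockCombStrong.lean`)
and `Quant.tree_relayCount_transfer` / `Quant.tree_real_openConn_eq_prod`, in the pattern of `…QuantFarRelayRowBlockCombStrong.lean` (whose
strong hypothesis `2j < (Σ|R k|)·∏_{G k} w` is here replaced by the MEAN).  Theorems only; no sorries; standard axioms.

* `Quant.BlockCombGate.farTree_blockComb_of_mean` — gate coordinates (product Bernoulli gates `q : E → [0,1]`, chain `ch`, private gate sets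
  `G k`, levels `lv k ≤ D`, class sizes `a k`): `2j < Σ_k a k·(∏_{i<lv k} q(ch i))·∏_{G k} q` (the mean of the reached mass) and `1 − marginal k ≤ t`
  for every live class ⟹ `P(Σ_{k reached} a k ≤ j) ≤ t`.
* `Quant.farRelayRow_tree_blockComb` — **ROUTE VOCABULARY: the body of `Quant.FarRelayRow` at EVERY layer `j`, under its own hypotheses
  `2j < Σ_{b∈A} P(o ↔ b)` and `P(o ↮ b) ≤ t` on `A`, for every weight function on `Sym2 (Fin n)` supported on a rooted spanning tree (root =
  observer `o ∉ A`) whose relay set carries a BLOCK-COMB PRESENTATION covering `A`** (chain `ch`, classes `R k` partitioning `A` with pairwise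
  disjoint private vertex sets `G k` off the chain and levels `lv k`, root path of every relay of class `k` = `ch''{i < lv k} ∪ G k`): then
  `P(#{b ∈ A | o ↔ b} ≤ j) ≤ t`.  Block-combs (LEAD-NOTES-G10 N21 (0)) are exactly the relay trees whose relay-free vertices form a chain below
  the observer: stars, block-stars, combs, block-combs with root blocks, multi-level hubs.  Supersedes (for these trees) `farRelayRow_star`,
  `farRelayRow_blockStar`, `farRelayRow_tree_comb`, `farRelayRow_tree_blockComb_cell/_strong/_tied`.
* `Quant.farRelayRow_tree_blockComb_root` — the `o ∈ A` cell (the observer a relay; presentation of `A.erase o`; layer shifted by one).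
[cite: KozmaNitzan2024, Lemma 2 (p. 6), Conjecture 3 (p. 15)] for the row; the theorem is [this work].
-/

noncomputable section

namespace Summit.CriticalPhenomena.PercolationContinuityZ3.Theorems

namespace Quant

open Finset MeasureTheory
open Literature.Probability.LatticeModels
open Literature.Probability.Percolation
open scoped Classical

namespace BlockCombGate

variable {E : Type*} [Fintype E] [DecidableEq E] {κ : Type*} [Fintype κ] [DecidableEq κ]

/-- product weight of a set of open blobs (canonical model of `…QuantBlockCombMergeModel`) -/
local notation3 "wt[" g ", " S "]" => ∏ k, (if k ∈ (S : Finset κ) then (g : κ → ℝ) k else 1 - (g : κ → ℝ) k)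
/-- depth law of the chain -/
local notation3 "pd[" D ", " q ", " i "]" =>
  (∏ i' ∈ Finset.range (i : ℕ), (q : ℕ → ℝ) i') * (if (i : ℕ) < (D : ℕ) then 1 - (q : ℕ → ℝ) i else 1)
/-- mass counted at depth `i` -/
local notation3 "mass[" lv ", " a ", " i ", " S "]" =>
  ∑ k ∈ (S : Finset κ).filter (fun k => (lv : κ → ℕ) k ≤ (i : ℕ)), ((a : κ → ℕ) k : ℕ)
/-- the canonical tail -/
local notation3 "TAIL[" D ", " q ", " lv ", " a ", " g ", " j "]" =>
  ∑ i ∈ Finset.range ((D : ℕ) + 1), pd[D, q, i] *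
    ∑ S : Finset κ, wt[g, S] * (if (j : ℕ) + 1 ≤ mass[lv, a, i, S] then (1 : ℝ) else 0)

/-- **THE BLOCK-COMB ROW, gate coordinates.**  Independent gates `q : E → [0,1]`; chain `ch : Fin D → E` (injective); blobs with pairwise disjoint
private gate sets `G k` off the chain, levels `lv k ≤ D` and class sizes `a k`; blob `k` is reached when the chain prefix of length `lv k` and all of
`G k` are open, contributing `a k` relays.  If `2j < Σ_k a k·(∏_{i<lv k} q(ch i))·∏_{G k} q` (the mean) and `1 − (∏_{i<lv k} q(ch i))·∏_{G k} q ≤ t` for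
every live blob, then `P(Σ_{k reached} a k ≤ j) ≤ t`.  Proof: `real_heavy_eq_tail` + `Quant.BlockComb.tail_ge_of_le_marg_of_mean`. [this work] -/
theorem farTree_blockComb_of_mean (q : E → unitInterval) (D : ℕ) (ch : Fin D → E) (hch : Function.Injective ch)
    (G : κ → Finset E) (hGdisj : ∀ k k', k ≠ k' → Disjoint (G k) (G k')) (hGch : ∀ k (i : Fin D), ch i ∉ G k)
    (lv : κ → ℕ) (hlv : ∀ k, lv k ≤ D) (a : κ → ℕ) (j : ℕ) (t : ℝ)
    (hmean : (2 * j : ℝ) < ∑ k, (a k : ℝ) *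
      ((∏ i ∈ Finset.range (lv k), (if h : i < D then ((q (ch ⟨i, h⟩) : unitInterval) : ℝ) else 1)) * ∏ e ∈ G k, (q e : ℝ)))
    (ht : ∀ k, 0 < a k →
      1 - (∏ i ∈ Finset.range (lv k), (if h : i < D then ((q (ch ⟨i, h⟩) : unitInterval) : ℝ) else 1)) *
        ∏ e ∈ G k, (q e : ℝ) ≤ t) :
    (prodBernoulli q).real {ω : Set E | ∑ k ∈ Finset.univ.filter
        (fun k => (∀ i : Fin D, (i : ℕ) < lv k → ch i ∈ ω) ∧ ((G k : Finset E) : Set E) ⊆ ω), a k ≤ j} ≤ t := by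
  set H : Set (Set E) := {ω : Set E | j + 1 ≤ ∑ k ∈ Finset.univ.filter
        (fun k => (∀ i : Fin D, (i : ℕ) < lv k → ch i ∈ ω) ∧ ((G k : Finset E) : Set E) ⊆ ω), a k} with hH
  have hcompl : {ω : Set E | ∑ k ∈ Finset.univ.filter
        (fun k => (∀ i : Fin D, (i : ℕ) < lv k → ch i ∈ ω) ∧ ((G k : Finset E) : Set E) ⊆ ω), a k ≤ j} = Hᶜ := by
    ext ω; simp only [hH, Set.mem_setOf_eq, Set.mem_compl_iff, not_le]; omega
  have hheavy : (prodBernoulli q).real H =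
      TAIL[D, (fun i => if h : i < D then ((q (ch ⟨i, h⟩) : unitInterval) : ℝ) else 1), lv, a,
        (fun k => ∏ e ∈ G k, (q e : ℝ)), j] :=
    real_heavy_eq_tail D q ch hch G hGdisj hGch lv hlv a j
  rw [hcompl, probReal_compl_eq_one_sub MeasurableSet.of_discrete, hheavy]
  set qc : ℕ → ℝ := fun i => if h : i < D then ((q (ch ⟨i, h⟩) : unitInterval) : ℝ) else 1 with hqc
  set g : κ → ℝ := fun k => ∏ e ∈ G k, (q e : ℝ) with hg
  have hqc01 : ∀ i, 0 ≤ qc i ∧ qc i ≤ 1 := fun i => by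
    by_cases h : i < D
    · simp only [hqc, dif_pos h]; exact ⟨(q _).2.1, (q _).2.2⟩
    · simp only [hqc, dif_neg h]; norm_num
  have hg01 : ∀ k, 0 ≤ g k ∧ g k ≤ 1 := fun k =>
    ⟨Finset.prod_nonneg fun e _ => (q e).2.1, Finset.prod_le_one (fun e _ => (q e).2.1) fun e _ => (q e).2.2⟩
  have hx : ∀ k, 0 < a k → 1 - t ≤ (∏ i ∈ Finset.range (lv k), qc i) * g k := fun k hk => by have := ht k hk; linarith
  have key := BlockComb.tail_ge_of_le_marg_of_mean D qc hqc01 lv a g hg01 j (fun k _ => hlv k) (1 - t) hx hmean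
  linarith

end BlockCombGate

variable {n : ℕ}

/-- **THE BLOCK-COMB ROW, route vocabulary: `Quant.FarRelayRow`'s body at every layer under its own hypotheses, for every tree-supported weight
pattern with a block-comb presentation covering the relays.**  Tree-supported weights `w` on `Sym2 (Fin n)` (root `o`, coordinates `par`/`depth`,
`hsupp`), relays `A ∌ o`, and a block-comb presentation (`ch`, `R`, `G`, `lv`): chain `ch` (injective), classes `R k ⊆ A` pairwise disjoint and
COVERING `A`, private vertex sets `G k` pairwise disjoint and off the chain, `lv k ≤ D`, and for every `b ∈ R k` the root path
`{par^[i] b | i ≤ depth b}` equals `ch''{i < lv k} ∪ G k`.  If `2j < Σ_{b∈A} P(o ↔ b)` and `P(o ↮ b) ≤ t` for all `b ∈ A`, then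
`P(#{b ∈ A | o ↔ b} ≤ j) ≤ t`. [this work] -/
theorem farRelayRow_tree_blockComb (n : ℕ) (w : Sym2 (Fin n) → unitInterval) (o : Fin n)
    (depth : Fin n → ℕ) (par : Fin n → Fin n)
    (hroot : ∀ x, x ≠ o → depth x = 0 → par x = o)
    (hstep : ∀ x, x ≠ o → depth x ≠ 0 → par x ≠ o ∧ depth (par x) + 1 = depth x)
    (hsupp : ∀ e, w e ≠ 0 → e.IsDiag ∨ ∃ x, x ≠ o ∧ e = s(par x, x))
    (A : Finset (Fin n)) (hoA : o ∉ A) (j : ℕ) (t : ℝ)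
    {κ : Type*} [Fintype κ] [DecidableEq κ]
    (D : ℕ) (ch : Fin D → Fin n) (hch : Function.Injective ch)
    (G : κ → Finset (Fin n)) (hGdisj : ∀ k k', k ≠ k' → Disjoint (G k) (G k')) (hGch : ∀ k (i : Fin D), ch i ∉ G k)
    (R : κ → Finset (Fin n)) (hRA : ∀ k, R k ⊆ A) (hRdisj : ∀ k k', k ≠ k' → Disjoint (R k) (R k'))
    (hcover : ∀ b ∈ A, ∃ k, b ∈ R k)
    (lv : κ → ℕ) (hlv : ∀ k, lv k ≤ D)
    (hpath : ∀ k, ∀ b ∈ R k, (Finset.range (depth b + 1)).image (fun i => par^[i] b) =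
      ((Finset.univ : Finset (Fin D)).filter (fun i : Fin D => i.val < lv k)).image ch ∪ G k)
    (hEN : (2 * j : ℝ) < ∑ b ∈ A, (prodBernoulli w).real (openConn o b))
    (ht : ∀ b ∈ A, (prodBernoulli w).real (openConn o b : Set (BondConfig (Fin n)))ᶜ ≤ t) :
    (prodBernoulli w).real {ω : BondConfig (Fin n) | (A.filter fun b => ω ∈ openConn o b).card ≤ j} ≤ t := by
  rw [tree_relayCount_transfer n w o depth par hroot hstep hsupp A j]
  set q : Fin n → unitInterval := fun x => if x = o then 1 else w s(par x, x) with hq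
  have hqy : ∀ y, y ≠ o → q y = w s(par y, y) := fun y hy => by simp only [hq, if_neg hy]
  have hAo : ∀ b ∈ A, b ≠ o := fun b hb hbo => hoA (hbo ▸ hb)
  -- the reached-class event contains the light relay-count event
  set F : Set (Set (Fin n)) := {ω' : Set (Fin n) | ∑ k ∈ Finset.univ.filter
      (fun k => (∀ i : Fin D, (i : ℕ) < lv k → ch i ∈ ω') ∧ ((G k : Finset (Fin n)) : Set (Fin n)) ⊆ ω'), (R k).card ≤ j} with hF
  have hsub : {ω' : Set (Fin n) | (A.filter fun a => a = o ∨ ∀ i, i ≤ depth a → par^[i] a ∈ ω').card ≤ j} ⊆ F := by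
    intro ω' hω'
    have hle : (A.filter fun a => a = o ∨ ∀ i, i ≤ depth a → par^[i] a ∈ ω').card ≤ j := hω'
    show ∑ k ∈ Finset.univ.filter
      (fun k => (∀ i : Fin D, (i : ℕ) < lv k → ch i ∈ ω') ∧ ((G k : Finset (Fin n)) : Set (Fin n)) ⊆ ω'), (R k).card ≤ j
    set Kr : Finset κ := Finset.univ.filter
      (fun k => (∀ i : Fin D, (i : ℕ) < lv k → ch i ∈ ω') ∧ ((G k : Finset (Fin n)) : Set (Fin n)) ⊆ ω') with hKr
    have hreach : ∀ k ∈ Kr, ∀ b ∈ R k, (b = o ∨ ∀ i, i ≤ depth b → par^[i] b ∈ ω') := by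
      intro k hk b hb
      obtain ⟨-, hpre, hG⟩ := Finset.mem_filter.1 hk
      refine Or.inr fun i hi => ?_
      have hmem : par^[i] b ∈ (Finset.range (depth b + 1)).image (fun i => par^[i] b) :=
        Finset.mem_image.2 ⟨i, Finset.mem_range.2 (by omega), rfl⟩
      rw [hpath k b hb, Finset.mem_union] at hmem
      rcases hmem with h | h
      · obtain ⟨i', hi', he⟩ := Finset.mem_image.1 h
        rw [← he]
        exact hpre i' (Finset.mem_filter.1 hi').2
      · exact hG (Finset.mem_coe.2 h)
    have hcard : ∑ k ∈ Kr, (R k).card = (Kr.biUnion R).card := by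
      rw [Finset.card_biUnion]
      intro k _ k' _ hkk'
      exact hRdisj k k' hkk'
    have hsubset : Kr.biUnion R ⊆ A.filter fun a => a = o ∨ ∀ i, i ≤ depth a → par^[i] a ∈ ω' := by
      intro b hb
      obtain ⟨k, hk, hbk⟩ := Finset.mem_biUnion.1 hb
      exact Finset.mem_filter.2 ⟨hRA k hbk, hreach k hk b hbk⟩
    calc ∑ k ∈ Kr, (R k).card = (Kr.biUnion R).card := hcard
      _ ≤ (A.filter fun a => a = o ∨ ∀ i, i ≤ depth a → par^[i] a ∈ ω').card := Finset.card_le_card hsubset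
      _ ≤ j := hle
  refine le_trans (measureReal_mono hsub (measure_ne_top _ _)) ?_
  -- the marginal of a relay `b ∈ R k` is the canonical marginal of its class
  have hmarg : ∀ k, ∀ b ∈ R k, (prodBernoulli w).real (openConn o b) =
      (∏ i ∈ Finset.range (lv k), (if h : i < D then ((q (ch ⟨i, h⟩) : unitInterval) : ℝ) else 1)) * ∏ e ∈ G k, (q e : ℝ) := by
    intro k b hb
    have hbA : b ∈ A := hRA k hb
    have hbo : b ≠ o := hAo b hbA
    rw [tree_real_openConn_eq_prod n w o depth par hroot hstep hsupp b hbo]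
    have hprod : ∏ i ∈ Finset.range (depth b + 1), (w s(par (par^[i] b), par^[i] b) : ℝ) =
        ∏ y ∈ (Finset.range (depth b + 1)).image (fun i => par^[i] b), (q y : ℝ) := by
      rw [Finset.prod_image (tree_iterate_injOn o depth par hstep b hbo)]
      refine Finset.prod_congr rfl fun i hi => ?_
      have hne := (tree_iterate_par o depth par hstep b hbo i (by have := Finset.mem_range.1 hi; omega)).1
      rw [hqy _ hne]
    have hdisj : Disjoint (((Finset.univ : Finset (Fin D)).filter (fun i : Fin D => i.val < lv k)).image ch) (G k) := by
      rw [Finset.disjoint_left]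
      intro y hy hyG
      obtain ⟨i, -, rfl⟩ := Finset.mem_image.1 hy
      exact hGch k i hyG
    have hrange : ∏ i ∈ Finset.range (lv k), (if h : i < D then ((q (ch ⟨i, h⟩) : unitInterval) : ℝ) else 1) =
        ∏ i ∈ Finset.range D, (if i < lv k then
          (if h : i < D then ((q (ch ⟨i, h⟩) : unitInterval) : ℝ) else 1) else 1) := by
      rw [← Finset.prod_filter]
      refine Finset.prod_congr ?_ fun _ _ => rfl
      ext i; simp only [Finset.mem_range, Finset.mem_filter]; have := hlv k; omega
    have hchain : ∏ y ∈ ((Finset.univ : Finset (Fin D)).filter (fun i : Fin D => i.val < lv k)).image ch, (q y : ℝ) =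
        ∏ i ∈ Finset.range (lv k), (if h : i < D then ((q (ch ⟨i, h⟩) : unitInterval) : ℝ) else 1) := by
      rw [Finset.prod_image (fun i _ i' _ h => hch h), Finset.prod_filter, hrange,
        ← Fin.prod_univ_eq_prod_range (fun m => if m < lv k then
          (if h : m < D then ((q (ch ⟨m, h⟩) : unitInterval) : ℝ) else 1) else 1) D]
      refine Finset.prod_congr rfl fun i _ => ?_
      by_cases hi : (i : ℕ) < lv k
      · rw [if_pos hi, if_pos hi, dif_pos i.2]
      · rw [if_neg hi, if_neg hi]
    rw [hprod, hpath k b hb, Finset.prod_union hdisj, hchain]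
  -- the light hypothesis: the marginal of a live class is the marginal of each of its relays
  have hlive : ∀ k, 0 < (R k).card ↔ (R k).Nonempty := fun k => Finset.card_pos
  have ht' : ∀ k, 0 < (R k).card →
      1 - (∏ i ∈ Finset.range (lv k), (if h : i < D then ((q (ch ⟨i, h⟩) : unitInterval) : ℝ) else 1)) *
        ∏ e ∈ G k, (q e : ℝ) ≤ t := by
    intro k hk
    obtain ⟨b, hb⟩ := (hlive k).1 hk
    have htb := ht b (hRA k hb)
    rw [probReal_compl_eq_one_sub (Set.toFinite _).measurableSet, hmarg k b hb] at htb
    exact htb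
  -- the mean: `Σ_{b∈A} P(o ↔ b) = Σ_k |R k| · marginal k`
  have hmean : (2 * j : ℝ) < ∑ k, ((R k).card : ℝ) *
      ((∏ i ∈ Finset.range (lv k), (if h : i < D then ((q (ch ⟨i, h⟩) : unitInterval) : ℝ) else 1)) * ∏ e ∈ G k, (q e : ℝ)) := by
    have hU : (Finset.univ : Finset κ).biUnion R = A := by
      refine Finset.Subset.antisymm (Finset.biUnion_subset.2 fun k _ => hRA k) fun b hb => ?_
      obtain ⟨k, hk⟩ := hcover b hb
      exact Finset.mem_biUnion.2 ⟨k, Finset.mem_univ _, hk⟩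
    have hsum : ∑ b ∈ A, (prodBernoulli w).real (openConn o b) =
        ∑ k, ∑ b ∈ R k, (prodBernoulli w).real (openConn o b) := by
      rw [← hU, Finset.sum_biUnion (fun k _ k' _ hkk' => hRdisj k k' hkk')]
    rw [hsum] at hEN
    refine hEN.trans_le (le_of_eq (Finset.sum_congr rfl fun k _ => ?_))
    rw [Finset.sum_congr rfl fun b hb => hmarg k b hb, Finset.sum_const, nsmul_eq_mul]
  exact BlockCombGate.farTree_blockComb_of_mean q D ch hch G hGdisj hGch lv hlv (fun k => (R k).card) j t hmean ht'

/-- **The `o ∈ A` cell** of `Quant.farRelayRow_tree_blockComb`: the observer itself a relay (always counted, `P(o ↔ o) = 1`); the presentation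
covers `A.erase o`; FAR's hypothesis `2j < Σ_{b∈A} P(o ↔ b)` at layer `j` gives the covered mean `> 2j − 1 ≥ 2(j−1)` at the shifted layer. [this work] -/
theorem farRelayRow_tree_blockComb_root (n : ℕ) (w : Sym2 (Fin n) → unitInterval) (o : Fin n)
    (depth : Fin n → ℕ) (par : Fin n → Fin n)
    (hroot : ∀ x, x ≠ o → depth x = 0 → par x = o)
    (hstep : ∀ x, x ≠ o → depth x ≠ 0 → par x ≠ o ∧ depth (par x) + 1 = depth x)
    (hsupp : ∀ e, w e ≠ 0 → e.IsDiag ∨ ∃ x, x ≠ o ∧ e = s(par x, x))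
    (A : Finset (Fin n)) (hoA : o ∈ A) (j : ℕ) (t : ℝ)
    {κ : Type*} [Fintype κ] [DecidableEq κ]
    (D : ℕ) (ch : Fin D → Fin n) (hch : Function.Injective ch)
    (G : κ → Finset (Fin n)) (hGdisj : ∀ k k', k ≠ k' → Disjoint (G k) (G k')) (hGch : ∀ k (i : Fin D), ch i ∉ G k)
    (R : κ → Finset (Fin n)) (hRA : ∀ k, R k ⊆ A.erase o) (hRdisj : ∀ k k', k ≠ k' → Disjoint (R k) (R k'))
    (hcover : ∀ b ∈ A.erase o, ∃ k, b ∈ R k)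
    (lv : κ → ℕ) (hlv : ∀ k, lv k ≤ D)
    (hpath : ∀ k, ∀ b ∈ R k, (Finset.range (depth b + 1)).image (fun i => par^[i] b) =
      ((Finset.univ : Finset (Fin D)).filter (fun i : Fin D => i.val < lv k)).image ch ∪ G k)
    (hEN : (2 * j : ℝ) < ∑ b ∈ A, (prodBernoulli w).real (openConn o b))
    (ht : ∀ b ∈ A, (prodBernoulli w).real (openConn o b : Set (BondConfig (Fin n)))ᶜ ≤ t) :
    (prodBernoulli w).real {ω : BondConfig (Fin n) | (A.filter fun b => ω ∈ openConn o b).card ≤ j} ≤ t := by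
  have ht0 : 0 ≤ t := le_trans measureReal_nonneg (ht o hoA)
  have hcard := QuantCensus.card_filter_conn_eq_erase_add_one A o hoA
  have hoA' : o ∉ A.erase o := Finset.notMem_erase o A
  rcases Nat.eq_zero_or_pos j with hj | hj
  · subst hj
    have hempty : {ω : BondConfig (Fin n) | (A.filter fun b => ω ∈ openConn o b).card ≤ 0} = ∅ := by
      rw [Set.eq_empty_iff_forall_notMem]
      intro ω hω
      have h1 := hcard ω
      have h2 : (A.filter fun b => ω ∈ openConn o b).card ≤ 0 := hω
      omega
    rw [hempty, measureReal_empty]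
    exact ht0
  · obtain ⟨j', rfl⟩ : ∃ j', j = j' + 1 := ⟨j - 1, by omega⟩
    -- the covered mean at the shifted layer: drop the observer's own term `P(o ↔ o) ≤ 1`
    have hEN' : (2 * j' : ℝ) < ∑ b ∈ A.erase o, (prodBernoulli w).real (openConn o b) := by
      have hsplit := Finset.sum_erase_add A (fun b => (prodBernoulli w).real (openConn o b)) hoA
      have hoo : (prodBernoulli w).real (openConn o o) ≤ 1 := by
        haveI : IsProbabilityMeasure (prodBernoulli w) := inferInstance
        exact measureReal_le_one
      have h1 : (2 * ((j' + 1 : ℕ) : ℝ)) = 2 * j' + 2 := by push_cast; ring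
      rw [h1] at hEN
      linarith
    have hfar := farRelayRow_tree_blockComb n w o depth par hroot hstep hsupp (A.erase o) hoA' j' t D ch hch
      G hGdisj hGch R hRA hRdisj hcover lv hlv hpath hEN' (fun b hb => ht b (Finset.mem_of_mem_erase hb))
    have hset : {ω : BondConfig (Fin n) | (A.filter fun b => ω ∈ openConn o b).card ≤ j' + 1} =
        {ω | ((A.erase o).filter fun b => ω ∈ openConn o b).card ≤ j'} := by
      ext ω
      simp only [Set.mem_setOf_eq]
      rw [hcard ω]
      omega
    rw [hset]
    exact hfar

end Quant

end Summit.CriticalPhenomena.PercolationContinuityZ3.Theorems
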